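import Mathlib
import HarnessLib
import Summits.FinalStateConjecture.FinalStateConjecture.Theorems.BondiDrainDispersalDrainImpliesDisperseHadamard
import Summits.FinalStateConjecture.FinalStateConjecture.Theorems.BondiDrainDispersalDrainImpliesDisperseFrameEstimates
import Literature.Geometry.Lorentzian.ChartCalculus

/-!
# Crux `DrainImpliesDisperse` (stmt-FinalStateConjecture-17283), negative side, chart rigidity:
# in a spacetime with a GLOBAL near-Minkowski frame, pinched future-oriented entire late charts are PROPER

Discharge of the chart-rigidity clause (P) of the construction hypothesis
`Negative.ProperPulsedObserverDevelopmentExists` (p157410): clause (P) asks that EVERY entire,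
`C²`-asymptotically flat, eventually future-oriented late chart of the flat background have eventually
closed half-space images — a statement about all charts. Here it is derived from ONE structural
property of the spacetime, a global near-Minkowski frame (mutually inverse smooth `Θ : E4 → M`,
`Ξ : M → E4`, `Θ` `C⁰`-pinched `‖Θ^*g − η‖ < 1/4` and future-oriented), plus a floor on the frame
time over the chart's late image (which for charts into `J⁺(ι X)` is a property of the frame alone):

**Theorem** (`isClosed_image_of_frame`). Let `Φ : U → M` (`U ⊇ {x⁰ > τ₀}` open in `E4`) be smooth,
pinched `‖(Φ^*g − η)(x)‖ < 1/4` and future-oriented (`Φ_*∂₀` future-directed) for `x⁰ > τ₁ ≥ τ₀`,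
with frame time `(Ξ ∘ Φ)⁰ ≥ T₀` there. Then `Φ({x⁰ ≥ τ₂})` is closed in `M` for every `τ₂ > τ₁`.

Proof (S. G. Harris' rigidity of complete spacelike hypersurfaces, in framed form). In frame
coordinates `Λ = Ξ ∘ Φ`, the slab maps `F_σ(y) = Λ(σ, y)̲ : ℝ³ → ℝ³`, `σ > τ₁`, are smooth with
coercive differential `‖dF_σ w‖ ≥ (3/4)‖w‖` (`framedChart_slab_expand`: slab vectors are uniformly
spacelike for the pinched `Φ^*g` and the frame reads `g` within `1/4` of `η`), so by Hadamard's global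
inverse function theorem (`le_norm_sub_of_le_norm_fderiv`) `(3/4)‖y − y'‖ ≤ ‖F_σ y − F_σ y'‖`; and the
frame time `Λ(σ, y)⁰` increases at rate `≥ 3/4` in `σ` (`framedChart_time_advance`). Hence a point
`Φ(σ, y)`, `σ ≥ τ₂`, lying frame-close to a given `q ∈ M` has `σ` bounded (by the floor and the rate)
and `y` bounded (by coercivity against `F_σ(0)`, continuous in `σ`), i.e. `(σ, y)` lies in a compact
box `K ⊆ {x⁰ ≥ τ₂}`; `Φ(K)` is compact, and `q ∈ closure Φ({x⁰ ≥ τ₂})` forces `q ∈ Φ(K)`.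

No injectivity of `Φ` is assumed (it follows on late slabs). Mathlib + the two tree helpers; no
definitions, no named facts. References: S. G. Harris, *Closed and complete spacelike hypersurfaces
in Minkowski space*, Class. Quantum Grav. 5 (1988) 111–119; J. Hadamard, Bull. SMF 34 (1906);
B. O'Neill, *Semi-Riemannian geometry* (1983), Ch. 5, Lemma 5.26. Line lead
`prover-line-stmt-FinalStateConjecture-17283-c5-0`, 2026-08-17.
-/

noncomputable section

set_option linter.dupNamespace false -- D-0017: `Summit.<S>.<S>.…` by design

open Set Function Filter TopologicalSpace Topology Metric
open scoped Manifold ContDiff Topology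

namespace Summit.FinalStateConjecture.FinalStateConjecture.Theorems.DrainImpliesDisperse.FramedProper

open Literature.Geometry.Lorentzian

/-! ### Coordinate bookkeeping on `E4` -/

/-- `(σ, y) = σ e₀ + (0, y)`. [folklore] -/
theorem ofTimeSpace_eq_smul_add (σ : ℝ) (y : E3) :
    E4.ofTimeSpace σ y = σ • E4.basisVector 0 + CoordSlice.incl y := by
  ext i
  refine Fin.cases ?_ (fun j ↦ ?_) i
  · simp [E4.basisVector, CoordSlice.incl_apply]
  · simp [E4.basisVector, CoordSlice.incl_apply, Fin.succ_ne_zero]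

/-- `y ↦ (σ, y)` has derivative `incl = (0, ·)` everywhere. [folklore] -/
theorem hasFDerivAt_ofTimeSpace (σ : ℝ) (y : E3) :
    HasFDerivAt (fun y : E3 ↦ E4.ofTimeSpace σ y) CoordSlice.incl y := by
  have h : (fun y : E3 ↦ E4.ofTimeSpace σ y) = fun y ↦ σ • E4.basisVector 0 + CoordSlice.incl y :=
    funext fun y ↦ ofTimeSpace_eq_smul_add σ y
  rw [h]
  exact (CoordSlice.incl.hasFDerivAt).const_add _

/-- `σ ↦ (σ, y)` has derivative `e₀` everywhere. [folklore] -/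
theorem hasDerivAt_ofTimeSpace (σ : ℝ) (y : E3) :
    HasDerivAt (fun σ : ℝ ↦ E4.ofTimeSpace σ y) (E4.basisVector 0) σ := by
  have h : (fun σ : ℝ ↦ E4.ofTimeSpace σ y) = fun σ ↦ σ • E4.basisVector 0 + CoordSlice.incl y :=
    funext fun σ ↦ ofTimeSpace_eq_smul_add σ y
  rw [h]
  simpa using ((hasDerivAt_id σ).smul_const (E4.basisVector 0)).add_const (CoordSlice.incl y)

/-! ### The properness theorem -/

/-- **In a spacetime with a global near-Minkowski frame, pinched future-oriented entire late charts
are proper.** Setting: `Θ : E4 → M`, `Ξ : M → E4` smooth with `Θ (Ξ p) = p`, `Θ` pinched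
(`‖(Θ^* g − η)(x)‖ < 1/4`) and future-oriented (`Θ_* ∂₀` future-directed); `Φ : U → M` smooth on an
open `U ⊇ {x⁰ > τ₀}`, pinched and future-oriented beyond `τ₁ ≥ τ₀`, with frame time `(Ξ (Φ x))⁰ ≥ T₀`
for `x⁰ > τ₁`. Then `Φ({x⁰ ≥ τ₂})` is closed for every `τ₂ > τ₁` (module docstring for the proof).
Harris, CQG 5 (1988) 111 (rigidity of complete spacelike hypersurfaces, framed form); Hadamard 1906.
[cite: ONeillSemiRiemannian1983, Ch. 5, Lemma 5.26] -/
theorem isClosed_image_of_frame (𝓢 : Spacetime 4)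
    (Θ : Minkowski.background.domain → 𝓢.carrier) (Ξ : 𝓢.carrier → E4)
    (hΘ : ContMDiff 𝓘(ℝ, E4) (𝓡 4) ∞ Θ) (hΞ : ContMDiff (𝓡 4) 𝓘(ℝ, E4) ∞ Ξ)
    (hΘΞ : ∀ p, Θ ⟨Ξ p, Opens.mem_top _⟩ = p)
    (hpinΘ : ∀ x, ‖𝓢.deviation Minkowski.background Θ x‖ < 1 / 4)
    (hfutΘ : ∀ x, 𝓢.timeOrientation.IsFutureDirected
      (mfderiv 𝓘(ℝ, E4) (𝓡 4) Θ x (E4.basisVector 0)))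
    (U : Opens E4) (Φ : U → 𝓢.carrier) (τ₀ τ₁ : ℝ) (h01 : τ₀ ≤ τ₁)
    (hU : Minkowski.lateRegion τ₀ ⊆ (U : Set E4))
    (hΦ : ContMDiff 𝓘(ℝ, E4) (𝓡 4) ∞ Φ)
    (hpin : ∀ x : U, τ₁ < (x : E4) 0 → ‖𝓢.deviation (Minkowski.backgroundOn U) Φ x‖ < 1 / 4)
    (hfut : ∀ x : U, τ₁ < (x : E4) 0 →
      𝓢.timeOrientation.IsFutureDirected (mfderiv 𝓘(ℝ, E4) (𝓡 4) Φ x (E4.basisVector 0)))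
    (T₀ : ℝ) (hfloor : ∀ x : U, τ₁ < (x : E4) 0 → T₀ ≤ E4.time (Ξ (Φ x))) :
    ∀ τ₂ : ℝ, τ₁ < τ₂ → IsClosed (Φ '' {x : U | τ₂ ≤ (x : E4) 0}) := by
  intro τ₂ h12
  classical
  -- two norm facts on `E4`
  have abs_apply_zero_le_norm : ∀ z : E4, |z 0| ≤ ‖z‖ := fun z ↦ by
    have h := PiLp.norm_apply_le z 0
    rwa [Real.norm_eq_abs] at h
  have norm_le_abs_add_norm_spatial : ∀ z : E4, ‖z‖ ≤ |z 0| + ‖E4.spatial z‖ := fun z ↦ by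
    have h := CoordSlice.norm_sq_eq z
    have h0 : 0 ≤ |z 0| + ‖E4.spatial z‖ := by positivity
    have h1 : ‖z‖ ^ 2 ≤ (|z 0| + ‖E4.spatial z‖) ^ 2 := by
      rw [h, add_sq, sq_abs]
      nlinarith [abs_nonneg (z 0), norm_nonneg (E4.spatial z)]
    exact (pow_le_pow_iff_left₀ (norm_nonneg _) h0 two_ne_zero).1 h1
  -- the frame coordinates of the chart and a representative on `E4`
  set Λ : U → E4 := fun x ↦ Ξ (Φ x) with hΛdef
  have hΛs : ContMDiff 𝓘(ℝ, E4) 𝓘(ℝ, E4) ∞ Λ := hΞ.comp hΦ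
  set Λ' : E4 → E4 := fun z ↦ if h : z ∈ U then Λ ⟨z, h⟩ else 0 with hΛ'def
  have hΛΛ' : ∀ x : U, Λ x = Λ' x := by
    intro x
    show Λ x = dite _ _ _
    rw [dif_pos x.2]
  have hΛ'cd : ∀ x : U, ContDiffAt ℝ ∞ Λ' x := fun x ↦
    (OpensChart.contMDiffAt_iff x Λ Λ' hΛΛ').1 (hΛs x)
  have hΛ'd : ∀ x : U, DifferentiableAt ℝ Λ' x := fun x ↦
    (hΛ'cd x).differentiableAt (by simp)
  have hmf : ∀ x : U, mfderiv 𝓘(ℝ, E4) 𝓘(ℝ, E4) Λ x = fderiv ℝ Λ' x := fun x ↦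
    OpensChart.mfderiv_eq x Λ Λ' hΛΛ' (hΛ'd x)
  have hchain : ∀ (x : U) (u : E4), fderiv ℝ Λ' x u =
      mfderiv (𝓡 4) 𝓘(ℝ, E4) Ξ (Φ x) (mfderiv 𝓘(ℝ, E4) (𝓡 4) Φ x u) := by
    intro x u
    rw [← hmf]
    have hΦd : MDifferentiableAt 𝓘(ℝ, E4) (𝓡 4) Φ x := (hΦ.mdifferentiable (by simp)) x
    have hΞd : MDifferentiableAt (𝓡 4) 𝓘(ℝ, E4) Ξ (Φ x) := (hΞ.mdifferentiable (by simp)) _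
    exact DFunLike.congr_fun (mfderiv_comp x hΞd hΦd) u
  -- the two frame inequalities at late points
  have hexp : ∀ x : U, τ₁ < (x : E4) 0 → ∀ w : E3,
      3 / 4 * ‖w‖ ≤ ‖E4.spatial (fderiv ℝ Λ' x (CoordSlice.incl w))‖ := by
    intro x hx w
    rw [hchain]
    exact norm_spatial_frame_slab_ge 𝓢 Θ Ξ hΘ hΞ hΘΞ hpinΘ Φ x (hpin x hx) w
  have hadv : ∀ x : U, τ₁ < (x : E4) 0 → 3 / 4 ≤ E4.time (fderiv ℝ Λ' x (E4.basisVector 0)) := by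
    intro x hx
    rw [hchain]
    exact frame_time_apply_zero_ge 𝓢 Θ Ξ hΘ hΞ hΘΞ hpinΘ hfutΘ Φ x (hpin x hx) (hfut x hx)
  -- late points of `E4` as points of `U`
  have hmem : ∀ (σ : ℝ) (y : E3), τ₁ < σ → E4.ofTimeSpace σ y ∈ U := fun σ y hσ ↦
    hU (show τ₀ < (E4.ofTimeSpace σ y) 0 by rw [E4.ofTimeSpace_apply_zero]; linarith)
  have hpt0 : ∀ (σ : ℝ) (y : E3) (hσ : τ₁ < σ),
      τ₁ < ((⟨E4.ofTimeSpace σ y, hmem σ y hσ⟩ : U) : E4) 0 := fun σ y hσ ↦ by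
    show τ₁ < (E4.ofTimeSpace σ y) 0
    rw [E4.ofTimeSpace_apply_zero]; exact hσ
  have hΛ'd' : ∀ (σ : ℝ) (y : E3), τ₁ < σ → DifferentiableAt ℝ Λ' (E4.ofTimeSpace σ y) :=
    fun σ y hσ ↦ hΛ'd ⟨E4.ofTimeSpace σ y, hmem σ y hσ⟩
  -- the slab maps `F_σ` in frame coordinates: smooth, with coercive differential, hence coercive
  set F : ℝ → E3 → E3 := fun σ y ↦ E4.spatial (Λ' (E4.ofTimeSpace σ y)) with hFdef
  have hFcd : ∀ σ, τ₁ < σ → ContDiff ℝ ∞ (F σ) := by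
    intro σ hσ
    rw [contDiff_iff_contDiffAt]
    intro y
    have h1 : ContDiffAt ℝ ∞ (fun y : E3 ↦ E4.ofTimeSpace σ y) y := by
      have h : (fun y : E3 ↦ E4.ofTimeSpace σ y) = fun y ↦ σ • E4.basisVector 0 + CoordSlice.incl y :=
        funext fun y ↦ ofTimeSpace_eq_smul_add σ y
      rw [h]
      exact (contDiff_const.add CoordSlice.incl.contDiff).contDiffAt
    have h2 : ContDiffAt ℝ ∞ Λ' (E4.ofTimeSpace σ y) := hΛ'cd ⟨E4.ofTimeSpace σ y, hmem σ y hσ⟩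
    exact E4.spatial.contDiff.contDiffAt.comp y (h2.comp y h1)
  have hFderiv : ∀ σ, τ₁ < σ → ∀ y w : E3,
      fderiv ℝ (F σ) y w = E4.spatial (fderiv ℝ Λ' (E4.ofTimeSpace σ y) (CoordSlice.incl w)) := by
    intro σ hσ y w
    have h := (E4.spatial.hasFDerivAt.comp (E4.ofTimeSpace σ y)
      ((hΛ'd' σ y hσ).hasFDerivAt)).comp y (hasFDerivAt_ofTimeSpace σ y)
    rw [show F σ = (⇑E4.spatial ∘ Λ') ∘ fun y : E3 ↦ E4.ofTimeSpace σ y from rfl, h.fderiv]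
    rfl
  have hFlow : ∀ σ, τ₁ < σ → ∀ y w : E3, 3 / 4 * ‖w‖ ≤ ‖fderiv ℝ (F σ) y w‖ := by
    intro σ hσ y w
    rw [hFderiv σ hσ]
    exact hexp ⟨E4.ofTimeSpace σ y, hmem σ y hσ⟩ (hpt0 σ y hσ) w
  have hcoer : ∀ σ, τ₁ < σ → ∀ y y' : E3, 3 / 4 * ‖y - y'‖ ≤ ‖F σ y - F σ y'‖ := fun σ hσ y y' ↦
    le_norm_sub_of_le_norm_fderiv' (F σ) (hFcd σ hσ) (by norm_num) (hFlow σ hσ) y y'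
  -- frame time along chart lines increases at rate `≥ 3/4`
  have hT : ∀ (y : E3) (a b : ℝ), τ₁ < a → a ≤ b →
      3 / 4 * (b - a) ≤ E4.time (Λ' (E4.ofTimeSpace b y)) - E4.time (Λ' (E4.ofTimeSpace a y)) := by
    intro y a b ha hab
    set f : ℝ → ℝ := fun σ ↦ E4.time (Λ' (E4.ofTimeSpace σ y)) with hfdef
    have hfd : ∀ σ, τ₁ < σ → HasDerivAt f
        (E4.time (fderiv ℝ Λ' (E4.ofTimeSpace σ y) (E4.basisVector 0))) σ := by
      intro σ hσ
      have h := (CoordSlice.dt.hasFDerivAt.comp (E4.ofTimeSpace σ y)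
        ((hΛ'd' σ y hσ).hasFDerivAt)).comp_hasDerivAt σ (hasDerivAt_ofTimeSpace σ y)
      exact h
    have hD : Convex ℝ (Ioi τ₁) := convex_Ioi τ₁
    have hcont : ContinuousOn f (Ioi τ₁) := fun σ hσ ↦ (hfd σ hσ).continuousAt.continuousWithinAt
    have hdiff : DifferentiableOn ℝ f (interior (Ioi τ₁)) := by
      rw [interior_Ioi]
      exact fun σ hσ ↦ (hfd σ hσ).differentiableAt.differentiableWithinAt
    have hge : ∀ σ ∈ interior (Ioi τ₁), (3 / 4 : ℝ) ≤ deriv f σ := by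
      rw [interior_Ioi]
      intro σ hσ
      rw [(hfd σ hσ).deriv]
      exact hadv ⟨E4.ofTimeSpace σ y, hmem σ y hσ⟩ (hpt0 σ y hσ)
    exact hD.mul_sub_le_image_sub_of_le_deriv hcont hdiff hge a ha b (lt_of_lt_of_le ha hab) hab
  -- closedness: a frame-localised compactness argument
  have h02 : τ₀ < τ₂ := lt_of_le_of_lt h01 h12
  apply isClosed_of_closure_subset
  intro q hq
  -- the frame neighbourhood of `q`
  set W : Set 𝓢.carrier := Ξ ⁻¹' ball (Ξ q) 1 with hWdef
  have hW : W ∈ 𝓝 q :=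
    (isOpen_ball.preimage hΞ.continuous).mem_nhds (show Ξ q ∈ ball (Ξ q) 1 from mem_ball_self one_pos)
  -- bounds: chart times `≤ σmax`, spatial size `≤ R`
  set Tq : ℝ := E4.time (Ξ q) with hTq
  set σmax : ℝ := τ₂ + 4 / 3 * (Tq + 1 - T₀) with hσmax
  have hcont0 : ContinuousOn (fun σ : ℝ ↦ F σ 0) (Icc τ₂ σmax) := by
    intro σ hσ
    have hσ1 : τ₁ < σ := h12.trans_le hσ.1
    have h := (E4.spatial.hasFDerivAt.comp (E4.ofTimeSpace σ 0)
      ((hΛ'd' σ 0 hσ1).hasFDerivAt)).comp_hasDerivAt σ (hasDerivAt_ofTimeSpace σ 0)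
    exact h.continuousAt.continuousWithinAt
  obtain ⟨R₀, hR₀⟩ := isCompact_Icc.exists_bound_of_continuousOn hcont0
  set R : ℝ := 4 / 3 * (‖E4.spatial (Ξ q)‖ + 1 + R₀) with hR
  -- the compact box
  set B : Set E4 := {z | τ₂ ≤ z 0 ∧ z 0 ≤ σmax ∧ ‖E4.spatial z‖ ≤ R} with hB
  have hBU : B ⊆ (U : Set E4) := fun z hz ↦ hU (show τ₀ < z 0 from h02.trans_le hz.1)
  have hc0 : Continuous fun z : E4 ↦ z 0 := PiLp.continuous_apply 2 _ 0
  have hBclosed : IsClosed B := by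
    refine (isClosed_le continuous_const hc0).inter ((isClosed_le hc0 continuous_const).inter ?_)
    exact isClosed_le (continuous_norm.comp E4.spatial.continuous) continuous_const
  have hBbdd : Bornology.IsBounded B := by
    rw [isBounded_iff_forall_norm_le]
    refine ⟨|τ₂| + |σmax| + R, fun z hz ↦ ?_⟩
    have h1 : |z 0| ≤ |τ₂| + |σmax| := by
      rcases le_or_gt 0 (z 0) with h | h
      · rw [abs_of_nonneg h]
        exact hz.2.1.trans ((le_abs_self σmax).trans (le_add_of_nonneg_left (abs_nonneg _)))
      · rw [abs_of_neg h]
        have : -z 0 ≤ -τ₂ := neg_le_neg hz.1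
        exact this.trans ((neg_le_abs τ₂).trans (le_add_of_nonneg_right (abs_nonneg _)))
    exact (norm_le_abs_add_norm_spatial z).trans (by linarith [hz.2.2])
  have hBcpt : IsCompact B := Metric.isCompact_of_isClosed_isBounded hBclosed hBbdd
  set K : Set U := Subtype.val ⁻¹' B with hK
  have hKcpt : IsCompact K := by
    refine (Topology.IsInducing.subtypeVal.isCompact_iff).2 ?_
    show IsCompact (Subtype.val '' (Subtype.val ⁻¹' B))
    rw [image_preimage_eq_inter_range, Subtype.range_coe, inter_eq_left.2 hBU]
    exact hBcpt
  have hKS : K ⊆ {x : U | τ₂ ≤ (x : E4) 0} := fun x hx ↦ hx.1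
  -- KEY: late points mapped frame-close to `q` lie in the box
  have hkey : ∀ x : U, τ₂ ≤ (x : E4) 0 → Φ x ∈ W → x ∈ K := by
    intro x hxS hxW
    set σ : ℝ := (x : E4) 0 with hσdef
    set y : E3 := E4.spatial (x : E4) with hydef
    have hσ1 : τ₁ < σ := h12.trans_le hxS
    have hxeq : (x : E4) = E4.ofTimeSpace σ y := (E4.ofTimeSpace_time_spatial (x : E4)).symm
    have hΛx : Λ' (E4.ofTimeSpace σ y) = Ξ (Φ x) := by
      rw [← hxeq, ← hΛΛ' x]
    have hdist : ‖Ξ (Φ x) - Ξ q‖ < 1 := by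
      have h : Ξ (Φ x) ∈ ball (Ξ q) 1 := hxW
      rwa [mem_ball, dist_eq_norm] at h
    -- time bound
    have hσmax : σ ≤ σmax := by
      have h1 := hT y τ₂ σ h12 hxS
      have h2 : T₀ ≤ E4.time (Λ' (E4.ofTimeSpace τ₂ y)) := by
        have h := hfloor ⟨E4.ofTimeSpace τ₂ y, hmem τ₂ y h12⟩ (hpt0 τ₂ y h12)
        rwa [show Ξ (Φ ⟨E4.ofTimeSpace τ₂ y, hmem τ₂ y h12⟩) = Λ' (E4.ofTimeSpace τ₂ y) from
          hΛΛ' ⟨E4.ofTimeSpace τ₂ y, hmem τ₂ y h12⟩] at h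
      have h3 : E4.time (Λ' (E4.ofTimeSpace σ y)) < Tq + 1 := by
        rw [hΛx]
        have h := abs_apply_zero_le_norm (Ξ (Φ x) - Ξ q)
        have h' : (Ξ (Φ x) - Ξ q) 0 = E4.time (Ξ (Φ x)) - Tq := by
          rw [hTq]; rfl
        rw [h'] at h
        linarith [le_abs_self (E4.time (Ξ (Φ x)) - Tq)]
      rw [hσmax]
      linarith
    -- spatial bound
    have hyR : ‖y‖ ≤ R := by
      have h1 := hcoer σ hσ1 y 0
      rw [sub_zero] at h1
      have h2 : ‖F σ y - E4.spatial (Ξ q)‖ < 1 := by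
        show ‖E4.spatial (Λ' (E4.ofTimeSpace σ y)) - E4.spatial (Ξ q)‖ < 1
        rw [hΛx, ← map_sub]
        exact (CoordSlice.norm_spatial_le _).trans_lt hdist
      have h3 : ‖F σ 0‖ ≤ R₀ := hR₀ σ ⟨hxS, hσmax⟩
      have h4 : ‖F σ y‖ ≤ ‖E4.spatial (Ξ q)‖ + 1 := by
        have := norm_sub_norm_le (F σ y) (E4.spatial (Ξ q))
        linarith [norm_nonneg (F σ y - E4.spatial (Ξ q))]
      have h5 : ‖F σ y - F σ 0‖ ≤ ‖E4.spatial (Ξ q)‖ + 1 + R₀ :=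
        (norm_sub_le _ _).trans (by linarith)
      rw [hR]
      linarith
    show (x : E4) ∈ B
    exact ⟨hxS, hσmax, hyR⟩
  -- conclusion
  have himg : IsClosed (Φ '' K) := (hKcpt.image hΦ.continuous).isClosed
  have hq' : q ∈ closure (Φ '' K) := by
    rw [mem_closure_iff_nhds] at hq ⊢
    intro V hV
    obtain ⟨p, ⟨hpV, hpW⟩, x, hxS, rfl⟩ := hq (V ∩ W) (inter_mem hV hW)
    exact ⟨Φ x, hpV, x, hkey x hxS hpW, rfl⟩
  rw [himg.closure_eq] at hq'
  obtain ⟨x, hxK, rfl⟩ := hq'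
  exact ⟨x, hKS hxK, rfl⟩

/-- **Pinched future-oriented entire late charts are proper in a framed spacetime** (registered
form of `isClosed_image_of_frame`). Harris, CQG 5 (1988) 111 (framed form); Hadamard 1906.
[cite: ONeillSemiRiemannian1983, Ch. 5, Lemma 5.26] -/
theorem framedChart_isClosed_image : ∀ (𝓢 : Literature.Geometry.Lorentzian.Spacetime 4) (Θ : Literature.Geometry.Lorentzian.Minkowski.background.domain → 𝓢.carrier) (Ξ : 𝓢.carrier → Literature.Geometry.Lorentzian.E4), ContMDiff 𝓘(ℝ, Literature.Geometry.Lorentzian.E4) (𝓡 4) ((⊤ : ℕ∞) : WithTop ℕ∞) Θ → ContMDiff (𝓡 4) 𝓘(ℝ, Literature.Geometry.Lorentzian.E4) ((⊤ : ℕ∞) : WithTop ℕ∞) Ξ → (∀ p : 𝓢.carrier, Θ ⟨Ξ p, TopologicalSpace.Opens.mem_top (Ξ p)⟩ = p) → (∀ x : Literature.Geometry.Lorentzian.Minkowski.background.domain, ‖𝓢.deviation Literature.Geometry.Lorentzian.Minkowski.background Θ x‖ < 1 / 4) → (∀ x : Literature.Geometry.Lorentzian.Minkowski.background.domain, 𝓢.timeOrientation.IsFutureDirected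 (mfderiv 𝓘(ℝ, Literature.Geometry.Lorentzian.E4) (𝓡 4) Θ x (Literature.Geometry.Lorentzian.E4.basisVector 0))) → ∀ (U : TopologicalSpace.Opens Literature.Geometry.Lorentzian.E4) (Φ : U → 𝓢.carrier) (τ₀ τ₁ : ℝ), τ₀ ≤ τ₁ → Literature.Geometry.Lorentzian.Minkowski.lateRegion τ₀ ⊆ (U : Set Literature.Geometry.Lorentzian.E4) → ContMDiff 𝓘(ℝ, Literature.Geometry.Lorentzian.E4) (𝓡 4) ((⊤ : ℕ∞) : WithTop ℕ∞) Φ → (∀ x : U, τ₁ < (x : Literature.Geometry.Lorentzian.E4) 0 → ‖𝓢.deviation (Literature.Geometry.Lorentzian.Minkowski.backgroundOn U) Φ x‖ < 1 / 4) → (∀ x : U, τ₁ < (x : Literature.Geometry.Lorentzian.E4) 0 → 𝓢.timeOrientation.IsFutureDirected (mfderiv 𝓘(ℝ, Literature.Geometry.Lorentzian.E4) (𝓡 4) Φ x (Literature.Geometry.Lorentzian.E4.basisVector 0))) → ∀ T₀ : ℝ, (∀ x : U, τ₁ < (x : Literature.Geometry.Lorentzian.E4) 0 → T₀ ≤ Literature.Geometry.Lorentzian.E4.time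 (Ξ (Φ x))) → ∀ τ₂ : ℝ, τ₁ < τ₂ → IsClosed (Φ '' {x : U | τ₂ ≤ (x : Literature.Geometry.Lorentzian.E4) 0}) := by
  intro 𝓢 Θ Ξ hΘ hΞ hΘΞ hpinΘ hfutΘ U Φ τ₀ τ₁ h01 hU hΦ hpin hfut T₀ hfloor τ₂ h12
  exact isClosed_image_of_frame 𝓢 Θ Ξ hΘ hΞ hΘΞ hpinΘ hfutΘ U Φ τ₀ τ₁ h01 hU hΦ hpin hfut T₀ hfloor
    τ₂ h12

end Summit.FinalStateConjecture.FinalStateConjecture.Theorems.DrainImpliesDisperse.FramedProper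

end
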